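import Summits.ResolutionOfSingularities.ResolutionOfSingularities.Theorems.FrobeniusLadderFInjectiveMacaulayficationPointCentreIdealSheaf
import Summits.ResolutionOfSingularities.ResolutionOfSingularities.Theorems.FrobeniusLadderFInjectiveMacaulayficationFiModelOfPointSupportedCentre
import HarnessLib

/-!
# Crux `FInjectiveMacaulayfication`: THE TOWER STEP — blowing up a point-centre chosen on one affine chart of a
non-affine model (line `Sketch`, cycle 7, lead assembly `stub_fiModelOfPointCentre`)

Support file for crux `stmt-ResolutionOfSingularities-15315` (`FrobeniusLadder.FInjectiveMacaulayfication`, route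
`ResolutionOfSingularities/FrobeniusLadder`, rung 2), line `Sketch`, registered stub `stub_fiModelOfPointCentre` (T2).

Every certified model so far (`Bl_𝔪 E₈⁰` in characteristic 5, p139106; the `E₇⁰`-type point in characteristic 3,
p145076) is ONE blow-up of an AFFINE base, while engines for the open core must ITERATE: blow up a closed point — or an
𝔪-primary-supported centre chosen on one affine chart — of a NON-affine intermediate model and re-certify. This file is
that step, as a corollary of the engine interface `FiModelOfCharts.stub_fiModelOfCharts` (p143445):

* `X₁` integral and locally Noetherian, every non-empty affine section ring of characteristic `p`;
* `b ∈ X₁` a closed point, `U ∋ b` an affine open, `I ⊆ Γ(X₁, U)` a non-zero ideal whose zero locus in `U` is `{b}`;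
* the full stalk clause (domain; systems of parameters weakly regular; parameter ideals Frobenius closed) at every
  point `x ≠ b` — the model is already good away from `b`;
* generators `xᵢ` of `I` whose chart rings `Γ(U)[I/xᵢ]` satisfy the Cohen–Macaulay + Frobenius-closed clause at
  their maximal ideals containing `xᵢ/1` (certified by Fedder E2 / deformation E1 / degree-zero descent E4).

Then `X₁` admits an F-injective Macaulayfication `X' → X₁` (proper, birational, `X'` integral, clause at every stalk):
extend `I` to the point-centre ideal sheaf `J` (`PointCentreIdealSheaf.stub_pointCentreIdealSheaf`, p148869: `J(U) = I`,
`J(V) = ⊤` off `b`, `supp J = {b}`) and blow it up (`FiModelOfPointSupportedCentre.stub_fiModelOfPointSupportedCentre`,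
p149626: `exists_isBlowup` + the interface on the cover `{U} ∪ {affine V ∌ b}`).

References: U. Görtz, T. Wedhorn, *Algebraic Geometry I*, Def. 13.90, Prop. 13.91; The Stacks Project, Tags 01J3,
0804, 02NS. [folklore]
-/

-- single-problem summit: the doubled namespace component is forced
set_option linter.dupNamespace false

noncomputable section

namespace Summit.ResolutionOfSingularities.ResolutionOfSingularities.Theorems.FInjectiveMacaulayfication.FiModelOfPointCentre

open AlgebraicGeometry CategoryTheory Literature.AlgebraicGeometry.Resolution

/-- **THE TOWER STEP** (registered stub `stub_fiModelOfPointCentre` of crux stmt-ResolutionOfSingularities-15315,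
line `Sketch`, cycle 7): `X₁` integral and locally Noetherian with all non-empty affine section rings of
characteristic `p`; `b` a closed point; `I ≠ 0` an ideal of an affine open `U ∋ b` with zero locus `{b}`; the full
stalk clause at every point `x ≠ b`; generators `xᵢ` of `I` whose chart rings `Γ(U)[I/xᵢ]` satisfy the
Cohen–Macaulay + Frobenius-closed clause at their maximal ideals containing `xᵢ/1`. Then `X₁` has an F-injective
Macaulayfication: a proper birational `X' → X₁` with `X'` integral and the full clause at every stalk — the blow-up
of the point-centre ideal sheaf of `I`. [folklore] -/
theorem stub_fiModelOfPointCentre : ∀ (p : ℕ) [Fact p.Prime] (X₁ : Scheme.{0}) [IsIntegral X₁]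
    [IsLocallyNoetherian X₁] (b : X₁), IsClosed ({b} : Set X₁) →
    ∀ (U : X₁.affineOpens), b ∈ (U : X₁.Opens) → ∀ (I : Ideal Γ(X₁, U)), I ≠ ⊥ →
    (∀ (x : X₁) (hx : x ∈ (U : X₁.Opens)), I ≤ (U.2.primeIdealOf ⟨x, hx⟩).asIdeal ↔ x = b) →
    (∀ V : X₁.affineOpens, ((V : X₁.Opens) : Set X₁).Nonempty → CharP Γ(X₁, V) p) →
    (∀ x : X₁, x ≠ b →
      IsDomain (X₁.presheaf.stalk x) ∧ ∀ d : ℕ, ringKrullDim (X₁.presheaf.stalk x) = d →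
        ∀ s : Fin d → X₁.presheaf.stalk x, (Ideal.span (Set.range s)).radical.IsMaximal →
          RingTheory.Sequence.IsWeaklyRegular (X₁.presheaf.stalk x) (List.ofFn s) ∧
          ∀ y : X₁.presheaf.stalk x, (∃ e : ℕ, y ^ p ^ e ∈ Ideal.span
            ((fun z : X₁.presheaf.stalk x => z ^ p ^ e) ''
              (Ideal.span (Set.range s) : Set (X₁.presheaf.stalk x)))) → y ∈ Ideal.span (Set.range s)) →
    (∃ (r : ℕ) (x : Fin r → Γ(X₁, U)) (hxI : ∀ i, x i ∈ I), Ideal.span (Set.range x) = I ∧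
        ∀ (i : Fin r), x i ≠ 0 →
          ∀ (Q : Ideal (HomogeneousLocalization.Away (reesGrading I) (reesT (x i) (hxI i)))) [Q.IsMaximal],
          reesChartBase (x i) (hxI i) (x i) ∈ Q →
          ∀ d : ℕ, ringKrullDim (Localization.AtPrime Q) = d → ∀ s : Fin d → Localization.AtPrime Q,
            (Ideal.span (Set.range s)).radical.IsMaximal →
              RingTheory.Sequence.IsWeaklyRegular (Localization.AtPrime Q) (List.ofFn s) ∧
              ∀ y : Localization.AtPrime Q, (∃ e : ℕ, y ^ p ^ e ∈ Ideal.span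
                ((fun z : Localization.AtPrime Q => z ^ p ^ e) ''
                  (Ideal.span (Set.range s) : Set (Localization.AtPrime Q)))) → y ∈ Ideal.span (Set.range s)) →
    ∃ (X' : Scheme.{0}) (π : X' ⟶ X₁), IsProper π ∧ Literature.AlgebraicGeometry.Resolution.IsBirational π ∧
      IsIntegral X' ∧
      ∀ x : X', IsDomain (X'.presheaf.stalk x) ∧ ∀ d : ℕ, ringKrullDim (X'.presheaf.stalk x) = d →
        ∀ s : Fin d → X'.presheaf.stalk x, (Ideal.span (Set.range s)).radical.IsMaximal →
          RingTheory.Sequence.IsWeaklyRegular (X'.presheaf.stalk x) (List.ofFn s) ∧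
          ∀ z : X'.presheaf.stalk x, (∃ e : ℕ, z ^ p ^ e ∈
              Ideal.span ((fun w : X'.presheaf.stalk x => w ^ p ^ e) ''
                (Ideal.span (Set.range s) : Set (X'.presheaf.stalk x)))) →
            z ∈ Ideal.span (Set.range s) := by
  intro p _ X₁ _ _ b hb U hbU I hI0 hzero hchar hoff hon
  -- the point-centre ideal sheaf `J` of `I`: `J(U) = I`, `supp J = {b}`, `J(V) = ⊤` off `b`
  obtain ⟨J, hJU, hsupp, htop⟩ :=
    PointCentreIdealSheaf.stub_pointCentreIdealSheaf X₁ U I b hbU hb hzero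
  -- replace `I` by `J(U)` everywhere (in particular inside the chart certificates)
  subst hJU
  exact FiModelOfPointSupportedCentre.stub_fiModelOfPointSupportedCentre p X₁ b hb J hsupp htop U hbU hI0
    hchar hoff hon

end Summit.ResolutionOfSingularities.ResolutionOfSingularities.Theorems.FInjectiveMacaulayfication.FiModelOfPointCentre

end
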